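import Summits.Ventures.CertifiedManyBodySolver.Observables.StiffnessVirtualStationFan
import Summits.Ventures.CertifiedManyBodySolver.Observables.StiffnessVirtualStationBoxes
import Summits.Ventures.CertifiedManyBodySolver.Observables.StiffnessApexTransportBandBoxes
import HarnessLib

/-!
# Ventures/CertifiedManyBodySolver — Observables/StiffnessVirtualStationFanBoxes.lean

HONEST FRAMING: one-sided certified CEILINGS on the uniform flux stiffness (t–t′ f-sum class) at half filling, AREA form (boxes) of the «VS × FAN» leaf of the
companion `Observables/StiffnessVirtualStationFan.lean` (the target's own `U`-chord × an apex-transported `n = 1` fan source with its `K₂` hinge, PRICED orientation);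
every leaf is CONDITIONAL on the rows it names; a ceiling never speaks to the presence of order; not a `T_c` estimate, not a superconductivity verdict; no number of record.
Zero compute, no definition, no claim node, no `sorry`.

Cell `pub/hubbard-fast` (D-0154 (1)(A) «CERTIFICATE REUSE along parameter paths»), seat `hubbard-fast-reuse-2` g9 (`prover-hubbard-fast-reuse-2-g9-0`), line «VIRTUAL STATION»,
object «VS × FAN BOXES».

THE POINT. With `d_A = U − U₁`, `K_A = −U₁t′` (chord hopping `κ_A = K_A/d_A`), `d_B = U − U_B`, `K_B = U s − U_B t′` (fan apex hopping `κ_B = K_B/d_B`), a `t′`-independent cap `H`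
(the `t′ = 0` cap of a coupling `U₂ ≥ U_b`, §3 of `StiffnessVirtualStation`), the fan's own orbit-lower value `v₂` and `K₂` ceiling `A₂`, the PRICED left leaf
(`κ_B ≤ 2s`, `κ_B < 2t′ ≤ κ_A`, `t′ ≤ 0`) clears to the polynomial inequality

  `P(U, t′) = 4c·(K_A d_B − K_B d_A) + (2t′d_B − K_B)·(U·lo₁ − U₁·H) + (K_A − 2t′d_A)·(4v₂ d_B + (K_B − 2s d_B)·A₂) ≥ 0`  (§1),

quadratic in `U` with the `t′`-affine leading coefficient `q(t′) = 2sA₂t′ − 8v₂t′ + 2lo₁t′ − lo₁s − 4cs` and quadratic in `t′` at fixed `U`; so a box `[U_a, U_b] × [t_a, t_b]` is worded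
by g6's `quadraticU_nonneg_on_box`: on the two `U`-EDGES, `P(U_e, t′) ≥ 0` and `P(U_e, t′) − q(t′)(U_b − U_a)²/4 ≥ 0` for every `t′ ∈ [t_a, t_b]` (four quadratics in `t′`,
certified by `nlinarith` in the instances), plus the bilinear/affine side conditions at the four corners (`box_corner_interp`) (§2). The `t′ ≥ 0` twins use the mirrored
fan witness (companion §3) with `K_B⁺ = U(−s) − U_B t′`, `P⁺(U, t′) = P(U, −t′)`.

* §1 `ObsStiffnessSeqCeilingAt_halfFilling_virtualStation_fanPriced_leftLeaf_cleared` / `…_mirrorFanPriced_rightLeaf_cleared`;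
* §2 `ObsStiffnessSeqCeilingAt_on_box_halfFilling_virtualStation_fanPriced_left` / `…_mirrorFanPriced_right`.

NOT said: the free fan orientation (`2s ≤ κ_B`) is not boxed here (points only, companion §2/§3); nothing at `T > 0`; `λ ≠ 0` words are not of this form.

References: T. Koma, H. Tasaki, J. Stat. Phys. 76 (1994) 745, §1 [KomaTasaki1994]; D. J. Scalapino, S. R. White, S.-C. Zhang, PRB 47 (1993) 7995, §II
[ScalapinoWhiteZhang1993]; E. H. Lieb, F. Y. Wu, Physica A 321 (2003) 1, §1 eq. (3) [LiebWuPhysicaA2003].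
-/

noncomputable section

namespace Summit.Ventures.CertifiedManyBodySolver.Observables

open Literature.MathematicalPhysics.QuantumLattice
open Literature.MathematicalPhysics.QuantumLattice.ThermodynamicLimit
open Literature.MathematicalPhysics.QuantumFieldTheory
open Literature.Probability.LatticeModels
open Matrix Finset Filter Topology HubbardWave0
open scoped Matrix BigOperators ComplexOrder

/-! ## §1 Cleared point leaves (PRICED fan orientation) -/

section Cleared

variable {U₁ lo₁ hi s₂ U₂ UP t'P : ℝ}

/-- **VS × FAN, `t′ ≤ 0`, PRICED, CLEARED.** The companion's `…_virtualStation_fanPriced_leftLeaf` with the side conditions and the word inequality multiplied out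
(`d_A = U − U₁ > 0`, `d_B = U − U_B > 0`, `K_A d_B − K_B d_A > 0`): `K_B ≤ 2s d_B`, `K_B < 2t′d_B`, and `0 ≤ P(U, t′)` (file header) give `ObsStiffnessSeqCeilingAt t′ U 1 c`.
[cite: KomaTasaki1994, §1] [cite: ScalapinoWhiteZhang1993, §II] [cite: LiebWuPhysicaA2003, §1 eq. (3)] -/
theorem ObsStiffnessSeqCeilingAt_halfFilling_virtualStation_fanPriced_leftLeaf_cleared (Uo₂ : ℝ) (hU₁0 : 0 ≤ U₁) (hUA : U₁ < UP)
    (hfloor : lo₁ ≤ energyDensityTT' 1 0 U₁ 1) (hcap : energyDensityTT' 1 t'P UP 1 ≤ hi)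
    (hU₂0 : 0 ≤ U₂) {v₂ : ℝ}
    (h₂ : ∀ (ω : InfVolFermionState 2) (Ls : ℕ → ℕ) (ψ : ∀ L, Fock (Orb (FermionTorus 2 L))),
      Tendsto Ls atTop atTop →
      (∀ j, IsGroundStateInSector (hubbardTorusTT' (Ls j) 1 s₂ U₂) (rectN 1 (Ls j)) 0 (ψ (Ls j))) →
      (∀ j, star (ψ (Ls j)) ⬝ᵥ ψ (Ls j) = 1) → ω.IsTorusLimitOf ψ Ls →
      v₂ ≤ ((Finset.univ : Finset (DihedralGroup 4)).card : ℝ)⁻¹ * ∑ g ∈ (Finset.univ : Finset (DihedralGroup 4)),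
        (ω.expect (d4ShiftSet g 0 (box 2 7)) (fermionEmbed (PolySite.d4Emb g 0 (box 2 7)) (-oddMomentObsTT s₂ Uo₂ 0))).re)
    {A₂ : ℝ}
    (hA₂ : ∀ (ω : InfVolFermionState 2) (Ls : ℕ → ℕ) (ψ : ∀ L, Fock (Orb (FermionTorus 2 L))),
      Tendsto Ls atTop atTop →
      (∀ j, IsGroundStateInSector (hubbardTorusTT' (Ls j) 1 s₂ U₂) (rectN 1 (Ls j)) 0 (ψ (Ls j))) →
      (∀ j, star (ψ (Ls j)) ⬝ᵥ ψ (Ls j) = 1) → ω.IsTorusLimitOf ψ Ls →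
      ω.meanEnergy (hubbardTTPrimeFermionInteraction 0 1 0) 1 ≤ A₂)
    (hUB : U₂ < UP) (ht : t'P ≤ 0)
    (hpriced : UP * s₂ - U₂ * t'P ≤ 2 * s₂ * (UP - U₂)) (hleft : UP * s₂ - U₂ * t'P < 2 * t'P * (UP - U₂)) (c : ℚ)
    (hP : 0 ≤ 4 * ((c : ℚ) : ℝ) * ((-(U₁ * t'P)) * (UP - U₂) - (UP * s₂ - U₂ * t'P) * (UP - U₁)) +
      (2 * t'P * (UP - U₂) - (UP * s₂ - U₂ * t'P)) * (UP * lo₁ - U₁ * hi) +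
      ((-(U₁ * t'P)) - 2 * t'P * (UP - U₁)) * (4 * v₂ * (UP - U₂) + ((UP * s₂ - U₂ * t'P) - 2 * s₂ * (UP - U₂)) * A₂)) :
    ObsStiffnessSeqCeilingAt t'P UP 1 c := by
  have hdA : 0 < UP - U₁ := sub_pos.2 hUA
  have hdB : 0 < UP - U₂ := sub_pos.2 hUB
  have hpr' : (UP * s₂ - U₂ * t'P) / (UP - U₂) ≤ 2 * s₂ := by rw [div_le_iff₀ hdB]; linarith
  have hleft' : (UP * s₂ - U₂ * t'P) / (UP - U₂) < 2 * t'P := by rw [div_lt_iff₀ hdB]; linarith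
  refine ObsStiffnessSeqCeilingAt_halfFilling_virtualStation_fanPriced_leftLeaf Uo₂ hU₁0 hUA hfloor hcap hU₂0 h₂ hA₂ hUB ht hpr' hleft' c ?_
  -- positivity of the cleared denominator E = K_A d_B − K_B d_A
  have hKA : 0 ≤ -(U₁ * t'P) - 2 * t'P * (UP - U₁) := by nlinarith
  have hE : 0 < (-(U₁ * t'P)) * (UP - U₂) - (UP * s₂ - U₂ * t'P) * (UP - U₁) := by nlinarith [mul_nonneg hKA hdB.le]
  have hden : (UP * 0 - U₁ * t'P) / (UP - U₁) - (UP * s₂ - U₂ * t'P) / (UP - U₂) =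
      ((-(U₁ * t'P)) * (UP - U₂) - (UP * s₂ - U₂ * t'P) * (UP - U₁)) / ((UP - U₁) * (UP - U₂)) := by
    field_simp; ring
  have hden_pos : 0 < (UP * 0 - U₁ * t'P) / (UP - U₁) - (UP * s₂ - U₂ * t'P) / (UP - U₂) := by
    rw [hden]; exact div_pos hE (mul_pos hdA hdB)
  have key : (2 * t'P - (UP * s₂ - U₂ * t'P) / (UP - U₂)) / ((UP * 0 - U₁ * t'P) / (UP - U₁) - (UP * s₂ - U₂ * t'P) / (UP - U₂)) *
        (((U₁ * hi - UP * lo₁) / (UP - U₁)) / 4) +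
      ((UP * 0 - U₁ * t'P) / (UP - U₁) - 2 * t'P) / ((UP * 0 - U₁ * t'P) / (UP - U₁) - (UP * s₂ - U₂ * t'P) / (UP - U₂)) *
        (-v₂ + (2 * s₂ - (UP * s₂ - U₂ * t'P) / (UP - U₂)) * A₂ / 4) =
      ((2 * t'P * (UP - U₂) - (UP * s₂ - U₂ * t'P)) * (U₁ * hi - UP * lo₁) +
        ((-(U₁ * t'P)) - 2 * t'P * (UP - U₁)) * (-(4 * v₂ * (UP - U₂)) + (2 * s₂ * (UP - U₂) - (UP * s₂ - U₂ * t'P)) * A₂)) /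
        (4 * ((-(U₁ * t'P)) * (UP - U₂) - (UP * s₂ - U₂ * t'P) * (UP - U₁))) := by
    have hdA' : UP - U₁ ≠ 0 := hdA.ne'
    have hdB' : UP - U₂ ≠ 0 := hdB.ne'
    have hE' : (-(U₁ * t'P)) * (UP - U₂) - (UP * s₂ - U₂ * t'P) * (UP - U₁) ≠ 0 := hE.ne'
    rw [hden]
    field_simp
    ring
  rw [key, div_le_iff₀ (by positivity)]
  nlinarith [hP]

/-- **VS × MIRRORED FAN, `t′ ≥ 0`, PRICED, CLEARED.** The companion's `…_virtualStation_mirrorFanPriced_rightLeaf` multiplied out: with `K_B⁺ = U(−s) − U_B t′`,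
`−K_B⁺ ≤ 2s d_B`, `2t′d_B < K_B⁺`, and `0 ≤ P⁺(U, t′) = 4c(K_B⁺d_A − K_A d_B) + (K_B⁺ − 2t′d_B)(U·lo₁ − U₁·H) + (2t′d_A − K_A)(4v₂ d_B + (−K_B⁺ − 2s d_B)A₂)`
(`K_A = −U₁t′`). [cite: KomaTasaki1994, §1] [cite: LiebWuPhysicaA2003, §1 eq. (3)] -/
theorem ObsStiffnessSeqCeilingAt_halfFilling_virtualStation_mirrorFanPriced_rightLeaf_cleared (Uo₂ : ℝ) (hU₁0 : 0 ≤ U₁) (hUA : U₁ < UP)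
    (hfloor : lo₁ ≤ energyDensityTT' 1 0 U₁ 1) (hcap : energyDensityTT' 1 t'P UP 1 ≤ hi)
    (hU₂0 : 0 ≤ U₂) {v₂ : ℝ}
    (h₂ : ∀ (ω : InfVolFermionState 2) (Ls : ℕ → ℕ) (ψ : ∀ L, Fock (Orb (FermionTorus 2 L))),
      Tendsto Ls atTop atTop →
      (∀ j, IsGroundStateInSector (hubbardTorusTT' (Ls j) 1 s₂ U₂) (rectN 1 (Ls j)) 0 (ψ (Ls j))) →
      (∀ j, star (ψ (Ls j)) ⬝ᵥ ψ (Ls j) = 1) → ω.IsTorusLimitOf ψ Ls →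
      v₂ ≤ ((Finset.univ : Finset (DihedralGroup 4)).card : ℝ)⁻¹ * ∑ g ∈ (Finset.univ : Finset (DihedralGroup 4)),
        (ω.expect (d4ShiftSet g 0 (box 2 7)) (fermionEmbed (PolySite.d4Emb g 0 (box 2 7)) (-oddMomentObsTT s₂ Uo₂ 0))).re)
    {A₂ : ℝ}
    (hA₂ : ∀ (ω : InfVolFermionState 2) (Ls : ℕ → ℕ) (ψ : ∀ L, Fock (Orb (FermionTorus 2 L))),
      Tendsto Ls atTop atTop →
      (∀ j, IsGroundStateInSector (hubbardTorusTT' (Ls j) 1 s₂ U₂) (rectN 1 (Ls j)) 0 (ψ (Ls j))) →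
      (∀ j, star (ψ (Ls j)) ⬝ᵥ ψ (Ls j) = 1) → ω.IsTorusLimitOf ψ Ls →
      ω.meanEnergy (hubbardTTPrimeFermionInteraction 0 1 0) 1 ≤ A₂)
    (hUB : U₂ < UP) (ht : 0 ≤ t'P)
    (hpriced : -(UP * (-s₂) - U₂ * t'P) ≤ 2 * s₂ * (UP - U₂)) (hright : 2 * t'P * (UP - U₂) < UP * (-s₂) - U₂ * t'P) (c : ℚ)
    (hP : 0 ≤ 4 * ((c : ℚ) : ℝ) * ((UP * (-s₂) - U₂ * t'P) * (UP - U₁) - (-(U₁ * t'P)) * (UP - U₂)) +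
      ((UP * (-s₂) - U₂ * t'P) - 2 * t'P * (UP - U₂)) * (UP * lo₁ - U₁ * hi) +
      (2 * t'P * (UP - U₁) - (-(U₁ * t'P))) * (4 * v₂ * (UP - U₂) + (-(UP * (-s₂) - U₂ * t'P) - 2 * s₂ * (UP - U₂)) * A₂)) :
    ObsStiffnessSeqCeilingAt t'P UP 1 c := by
  have hdA : 0 < UP - U₁ := sub_pos.2 hUA
  have hdB : 0 < UP - U₂ := sub_pos.2 hUB
  have hpr' : -((UP * (-s₂) - U₂ * t'P) / (UP - U₂)) ≤ 2 * s₂ := by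
    rw [← neg_div, div_le_iff₀ hdB]; linarith
  have hright' : 2 * t'P < (UP * (-s₂) - U₂ * t'P) / (UP - U₂) := by rw [lt_div_iff₀ hdB]; linarith
  refine ObsStiffnessSeqCeilingAt_halfFilling_virtualStation_mirrorFanPriced_rightLeaf Uo₂ hU₁0 hUA hfloor hcap hU₂0 h₂ hA₂ hUB ht hpr' hright' c ?_
  have hKA : 0 ≤ 2 * t'P * (UP - U₁) - (-(U₁ * t'P)) := by nlinarith
  have hE : 0 < (UP * (-s₂) - U₂ * t'P) * (UP - U₁) - (-(U₁ * t'P)) * (UP - U₂) := by nlinarith [mul_nonneg hKA hdB.le]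
  have hden : (UP * (-s₂) - U₂ * t'P) / (UP - U₂) - (UP * 0 - U₁ * t'P) / (UP - U₁) =
      ((UP * (-s₂) - U₂ * t'P) * (UP - U₁) - (-(U₁ * t'P)) * (UP - U₂)) / ((UP - U₁) * (UP - U₂)) := by
    field_simp; ring
  have key : ((UP * (-s₂) - U₂ * t'P) / (UP - U₂) - 2 * t'P) / ((UP * (-s₂) - U₂ * t'P) / (UP - U₂) - (UP * 0 - U₁ * t'P) / (UP - U₁)) *
        (((U₁ * hi - UP * lo₁) / (UP - U₁)) / 4) +
      (2 * t'P - (UP * 0 - U₁ * t'P) / (UP - U₁)) / ((UP * (-s₂) - U₂ * t'P) / (UP - U₂) - (UP * 0 - U₁ * t'P) / (UP - U₁)) *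
        (-v₂ + (2 * s₂ + (UP * (-s₂) - U₂ * t'P) / (UP - U₂)) * A₂ / 4) =
      (((UP * (-s₂) - U₂ * t'P) - 2 * t'P * (UP - U₂)) * (U₁ * hi - UP * lo₁) +
        (2 * t'P * (UP - U₁) - (-(U₁ * t'P))) * (-(4 * v₂ * (UP - U₂)) + (2 * s₂ * (UP - U₂) + (UP * (-s₂) - U₂ * t'P)) * A₂)) /
        (4 * ((UP * (-s₂) - U₂ * t'P) * (UP - U₁) - (-(U₁ * t'P)) * (UP - U₂))) := by
    have hdA' : UP - U₁ ≠ 0 := hdA.ne'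
    have hdB' : UP - U₂ ≠ 0 := hdB.ne'
    have hE' : (UP * (-s₂) - U₂ * t'P) * (UP - U₁) - (-(U₁ * t'P)) * (UP - U₂) ≠ 0 := hE.ne'
    rw [hden]
    field_simp
    ring
  rw [key, div_le_iff₀ (by positivity)]
  nlinarith [hP]

end Cleared

/-! ## §2 THE BOX THEOREMS (PRICED fan orientation): two `U`-edge families + corner side conditions -/

section Box

variable {U₁ lo₁ s₂ U₂ : ℝ}

/-- **VS × FAN BOX, `t′ ≤ 0`, PRICED** (`n = 1`). Chord floor `lo₁ ≤ e(1, 0, U₁, 1)` (`0 ≤ U₁ < U_a`), cap `e(1, 0, U_c, 1) ≤ hi` at a coupling `U_c ≥ U_b` (a cap at every point of the box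
by `energyDensityTT'_halfFilling_cap_of_tPrime_zero_cap_above`); fan class `(s₂, U_B, 1)` (`0 ≤ U_B < U_a`) with own family `v₂` and ceiling `A₂`; box `U_a < U_b`, `t_a < t_b ≤ 0`; at the four
corners `K_B ≤ 2s₂ d_B` (affine) and `K_B < 2t′d_B` (bilinear); on the two `U`-edges, for every `t′ ∈ [t_a, t_b]`: `0 ≤ P(U_e, t′)` and `0 ≤ P(U_e, t′) − q(t′)(U_b − U_a)²/4` with
`q(t′) = 2s₂A₂t′ − 8v₂t′ + 2lo₁t′ − lo₁s₂ − 4cs₂` the leading coefficient of `P(·, t′)` (a quadratic in `U`). Then `ObsStiffnessSeqCeilingAt t′ U 1 c` at every point of the box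
(`quadraticU_nonneg_on_box` at fixed `t′`, then §1). [cite: KomaTasaki1994, §1] [cite: ScalapinoWhiteZhang1993, §II] [cite: LiebWuPhysicaA2003, §1 eq. (3)] -/
theorem ObsStiffnessSeqCeilingAt_on_box_halfFilling_virtualStation_fanPriced_left (Uo₂ : ℝ) (hU₁0 : 0 ≤ U₁)
    (hfloor : lo₁ ≤ energyDensityTT' 1 0 U₁ 1) {Uc hi : ℝ} (hcap : energyDensityTT' 1 0 Uc 1 ≤ hi)
    (hU₂0 : 0 ≤ U₂) {v₂ : ℝ}
    (h₂ : ∀ (ω : InfVolFermionState 2) (Ls : ℕ → ℕ) (ψ : ∀ L, Fock (Orb (FermionTorus 2 L))),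
      Tendsto Ls atTop atTop →
      (∀ j, IsGroundStateInSector (hubbardTorusTT' (Ls j) 1 s₂ U₂) (rectN 1 (Ls j)) 0 (ψ (Ls j))) →
      (∀ j, star (ψ (Ls j)) ⬝ᵥ ψ (Ls j) = 1) → ω.IsTorusLimitOf ψ Ls →
      v₂ ≤ ((Finset.univ : Finset (DihedralGroup 4)).card : ℝ)⁻¹ * ∑ g ∈ (Finset.univ : Finset (DihedralGroup 4)),
        (ω.expect (d4ShiftSet g 0 (box 2 7)) (fermionEmbed (PolySite.d4Emb g 0 (box 2 7)) (-oddMomentObsTT s₂ Uo₂ 0))).re)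
    {A₂ : ℝ}
    (hA₂ : ∀ (ω : InfVolFermionState 2) (Ls : ℕ → ℕ) (ψ : ∀ L, Fock (Orb (FermionTorus 2 L))),
      Tendsto Ls atTop atTop →
      (∀ j, IsGroundStateInSector (hubbardTorusTT' (Ls j) 1 s₂ U₂) (rectN 1 (Ls j)) 0 (ψ (Ls j))) →
      (∀ j, star (ψ (Ls j)) ⬝ᵥ ψ (Ls j) = 1) → ω.IsTorusLimitOf ψ Ls →
      ω.meanEnergy (hubbardTTPrimeFermionInteraction 0 1 0) 1 ≤ A₂)
    {Ua Ub ta tb : ℝ} (hUa : U₁ < Ua) (hUBa : U₂ < Ua) (hab : Ua < Ub) (hbc : Ub ≤ Uc) (htab : ta < tb) (htb : tb ≤ 0)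
    (hpr₁ : Ua * s₂ - U₂ * ta ≤ 2 * s₂ * (Ua - U₂)) (hpr₂ : Ua * s₂ - U₂ * tb ≤ 2 * s₂ * (Ua - U₂))
    (hpr₃ : Ub * s₂ - U₂ * ta ≤ 2 * s₂ * (Ub - U₂)) (hpr₄ : Ub * s₂ - U₂ * tb ≤ 2 * s₂ * (Ub - U₂))
    (hlf₁ : Ua * s₂ - U₂ * ta < 2 * ta * (Ua - U₂)) (hlf₂ : Ua * s₂ - U₂ * tb < 2 * tb * (Ua - U₂))
    (hlf₃ : Ub * s₂ - U₂ * ta < 2 * ta * (Ub - U₂)) (hlf₄ : Ub * s₂ - U₂ * tb < 2 * tb * (Ub - U₂)) (c : ℚ)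
    (hPa : ∀ t ∈ Set.Icc ta tb, 0 ≤ 4 * ((c : ℚ) : ℝ) * ((-(U₁ * t)) * (Ua - U₂) - (Ua * s₂ - U₂ * t) * (Ua - U₁)) +
      (2 * t * (Ua - U₂) - (Ua * s₂ - U₂ * t)) * (Ua * lo₁ - U₁ * hi) +
      ((-(U₁ * t)) - 2 * t * (Ua - U₁)) * (4 * v₂ * (Ua - U₂) + ((Ua * s₂ - U₂ * t) - 2 * s₂ * (Ua - U₂)) * A₂))
    (hPb : ∀ t ∈ Set.Icc ta tb, 0 ≤ 4 * ((c : ℚ) : ℝ) * ((-(U₁ * t)) * (Ub - U₂) - (Ub * s₂ - U₂ * t) * (Ub - U₁)) +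
      (2 * t * (Ub - U₂) - (Ub * s₂ - U₂ * t)) * (Ub * lo₁ - U₁ * hi) +
      ((-(U₁ * t)) - 2 * t * (Ub - U₁)) * (4 * v₂ * (Ub - U₂) + ((Ub * s₂ - U₂ * t) - 2 * s₂ * (Ub - U₂)) * A₂))
    (hQa : ∀ t ∈ Set.Icc ta tb, 0 ≤ 4 * ((c : ℚ) : ℝ) * ((-(U₁ * t)) * (Ua - U₂) - (Ua * s₂ - U₂ * t) * (Ua - U₁)) +
      (2 * t * (Ua - U₂) - (Ua * s₂ - U₂ * t)) * (Ua * lo₁ - U₁ * hi) +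
      ((-(U₁ * t)) - 2 * t * (Ua - U₁)) * (4 * v₂ * (Ua - U₂) + ((Ua * s₂ - U₂ * t) - 2 * s₂ * (Ua - U₂)) * A₂) -
      (2 * s₂ * A₂ * t - 8 * v₂ * t + 2 * lo₁ * t - lo₁ * s₂ - 4 * ((c : ℚ) : ℝ) * s₂) * ((Ub - Ua) ^ 2 / 4))
    (hQb : ∀ t ∈ Set.Icc ta tb, 0 ≤ 4 * ((c : ℚ) : ℝ) * ((-(U₁ * t)) * (Ub - U₂) - (Ub * s₂ - U₂ * t) * (Ub - U₁)) +
      (2 * t * (Ub - U₂) - (Ub * s₂ - U₂ * t)) * (Ub * lo₁ - U₁ * hi) +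
      ((-(U₁ * t)) - 2 * t * (Ub - U₁)) * (4 * v₂ * (Ub - U₂) + ((Ub * s₂ - U₂ * t) - 2 * s₂ * (Ub - U₂)) * A₂) -
      (2 * s₂ * A₂ * t - 8 * v₂ * t + 2 * lo₁ * t - lo₁ * s₂ - 4 * ((c : ℚ) : ℝ) * s₂) * ((Ub - Ua) ^ 2 / 4)) :
    ∀ U ∈ Set.Icc Ua Ub, ∀ t ∈ Set.Icc ta tb, ObsStiffnessSeqCeilingAt t U 1 c := by
  intro U hU t ht
  have hUa0 : 0 ≤ Ua := hU₁0.trans hUa.le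
  have hpos : 0 < (Ub - Ua) * (tb - ta) := mul_pos (sub_pos.2 hab) (sub_pos.2 htab)
  -- side conditions at (U, t) by corner interpolation
  have hpr : U * s₂ - U₂ * t ≤ 2 * s₂ * (U - U₂) := by
    have h := box_corner_interp hU ht (sub_nonneg.2 hpr₁) (sub_nonneg.2 hpr₂) (sub_nonneg.2 hpr₃) (sub_nonneg.2 hpr₄)
    have key : (Ub - Ua) * (tb - ta) * (2 * s₂ * (U - U₂) - (U * s₂ - U₂ * t)) =
        (Ub - U) * (tb - t) * (2 * s₂ * (Ua - U₂) - (Ua * s₂ - U₂ * ta)) + (Ub - U) * (t - ta) * (2 * s₂ * (Ua - U₂) - (Ua * s₂ - U₂ * tb)) +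
        (U - Ua) * (tb - t) * (2 * s₂ * (Ub - U₂) - (Ub * s₂ - U₂ * ta)) + (U - Ua) * (t - ta) * (2 * s₂ * (Ub - U₂) - (Ub * s₂ - U₂ * tb)) := by
      ring
    have hnn : 0 ≤ (Ub - Ua) * (tb - ta) * (2 * s₂ * (U - U₂) - (U * s₂ - U₂ * t)) := by rw [key]; exact h
    have := (mul_nonneg_iff_of_pos_left hpos).1 hnn
    linarith
  have hlf : U * s₂ - U₂ * t < 2 * t * (U - U₂) := by
    -- strict: interpolate the nonnegative slacks, at least one corner weight is positive
    obtain ⟨hUa', hUb'⟩ := hU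
    obtain ⟨hta', htb'⟩ := ht
    have key : (Ub - Ua) * (tb - ta) * (2 * t * (U - U₂) - (U * s₂ - U₂ * t)) =
        (Ub - U) * (tb - t) * (2 * ta * (Ua - U₂) - (Ua * s₂ - U₂ * ta)) + (Ub - U) * (t - ta) * (2 * tb * (Ua - U₂) - (Ua * s₂ - U₂ * tb)) +
        (U - Ua) * (tb - t) * (2 * ta * (Ub - U₂) - (Ub * s₂ - U₂ * ta)) + (U - Ua) * (t - ta) * (2 * tb * (Ub - U₂) - (Ub * s₂ - U₂ * tb)) := by
      ring
    set m := min (min (2 * ta * (Ua - U₂) - (Ua * s₂ - U₂ * ta)) (2 * tb * (Ua - U₂) - (Ua * s₂ - U₂ * tb)))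
      (min (2 * ta * (Ub - U₂) - (Ub * s₂ - U₂ * ta)) (2 * tb * (Ub - U₂) - (Ub * s₂ - U₂ * tb))) with hm
    have hm0 : 0 < m := by
      simp only [hm, lt_min_iff]; exact ⟨⟨by linarith, by linarith⟩, ⟨by linarith, by linarith⟩⟩
    have hm1 : m ≤ 2 * ta * (Ua - U₂) - (Ua * s₂ - U₂ * ta) := le_trans (min_le_left _ _) (min_le_left _ _)
    have hm2 : m ≤ 2 * tb * (Ua - U₂) - (Ua * s₂ - U₂ * tb) := le_trans (min_le_left _ _) (min_le_right _ _)
    have hm3 : m ≤ 2 * ta * (Ub - U₂) - (Ub * s₂ - U₂ * ta) := le_trans (min_le_right _ _) (min_le_left _ _)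
    have hm4 : m ≤ 2 * tb * (Ub - U₂) - (Ub * s₂ - U₂ * tb) := le_trans (min_le_right _ _) (min_le_right _ _)
    have hw : (Ub - U) * (tb - t) + (Ub - U) * (t - ta) + (U - Ua) * (tb - t) + (U - Ua) * (t - ta) = (Ub - Ua) * (tb - ta) := by ring
    have hge : m * ((Ub - Ua) * (tb - ta)) ≤ (Ub - Ua) * (tb - ta) * (2 * t * (U - U₂) - (U * s₂ - U₂ * t)) := by
      rw [key, ← hw]
      nlinarith [mul_nonneg (sub_nonneg.2 hUb') (sub_nonneg.2 htb'), mul_nonneg (sub_nonneg.2 hUb') (sub_nonneg.2 hta'),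
        mul_nonneg (sub_nonneg.2 hUa') (sub_nonneg.2 htb'), mul_nonneg (sub_nonneg.2 hUa') (sub_nonneg.2 hta')]
    have h2 : 0 < (Ub - Ua) * (tb - ta) * (2 * t * (U - U₂) - (U * s₂ - U₂ * t)) := lt_of_lt_of_le (mul_pos hm0 hpos) hge
    have := (mul_pos_iff_of_pos_left hpos).1 h2
    linarith
  have hcapU : energyDensityTT' 1 t U 1 ≤ hi :=
    energyDensityTT'_halfFilling_cap_of_tPrime_zero_cap_above t (hUa0.trans hU.1) (hU.2.trans hbc) hcap
  refine ObsStiffnessSeqCeilingAt_halfFilling_virtualStation_fanPriced_leftLeaf_cleared Uo₂ hU₁0 (hUa.trans_le hU.1) hfloor hcapU hU₂0 h₂ hA₂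
    (hUBa.trans_le hU.1) (ht.2.trans htb) hpr hlf c ?_
  -- P(U, t) = q U² + p U + r; g6's quadratic-in-U box lemma with the two edge families
  set q : ℝ := 2 * s₂ * A₂ * t - 8 * v₂ * t + 2 * lo₁ * t - lo₁ * s₂ - 4 * ((c : ℚ) : ℝ) * s₂ with hq
  set p : ℝ := 2 * U₂ * A₂ * t ^ 2 - 4 * s₂ * U₂ * A₂ * t - U₁ * s₂ * A₂ * t + 8 * U₂ * v₂ * t + 4 * U₁ * v₂ * t - 2 * hi * U₁ * t +
    hi * U₁ * s₂ - lo₁ * U₂ * t + 4 * ((c : ℚ) : ℝ) * U₂ * t - 4 * ((c : ℚ) : ℝ) * U₁ * t + 4 * ((c : ℚ) : ℝ) * U₁ * s₂ with hp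
  set r : ℝ := -(U₁ * U₂ * A₂ * t ^ 2) + 2 * U₁ * s₂ * U₂ * A₂ * t - 4 * U₁ * U₂ * v₂ * t + hi * U₁ * U₂ * t with hr
  have hPid : ∀ X : ℝ, 4 * ((c : ℚ) : ℝ) * ((-(U₁ * t)) * (X - U₂) - (X * s₂ - U₂ * t) * (X - U₁)) +
      (2 * t * (X - U₂) - (X * s₂ - U₂ * t)) * (X * lo₁ - U₁ * hi) +
      ((-(U₁ * t)) - 2 * t * (X - U₁)) * (4 * v₂ * (X - U₂) + ((X * s₂ - U₂ * t) - 2 * s₂ * (X - U₂)) * A₂) = q * X ^ 2 + p * X + r := by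
    intro X; rw [hq, hp, hr]; ring
  have ha := hPa t ht; have hb := hPb t ht; have haW := hQa t ht; have hbW := hQb t ht
  rw [hPid Ua] at ha haW; rw [hPid Ub] at hb hbW
  rw [hPid U]
  exact quadraticU_nonneg_on_box hab hU ha hb (by linarith) (by linarith)

/-- **VS × MIRRORED FAN BOX, `t′ ≥ 0`, PRICED** (`n = 1`, all sides). Same data; box `U_a < U_b`, `0 ≤ t_a < t_b`; corners: `−K_B⁺ ≤ 2s₂ d_B` and `2t′d_B < K_B⁺`
(`K_B⁺ = U(−s₂) − U_B t′`); edges: `0 ≤ P⁺(U_e, t′)` and `0 ≤ P⁺(U_e, t′) − q⁺(t′)(U_b − U_a)²/4` with `q⁺(t′) = −2s₂A₂t′ + 8v₂t′ − 2lo₁t′ − lo₁s₂ − 4cs₂`. Then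
`ObsStiffnessSeqCeilingAt t′ U 1 c` on the box. [cite: KomaTasaki1994, §1] [cite: LiebWuPhysicaA2003, §1 eq. (3)] -/
theorem ObsStiffnessSeqCeilingAt_on_box_halfFilling_virtualStation_mirrorFanPriced_right (Uo₂ : ℝ) (hU₁0 : 0 ≤ U₁)
    (hfloor : lo₁ ≤ energyDensityTT' 1 0 U₁ 1) {Uc hi : ℝ} (hcap : energyDensityTT' 1 0 Uc 1 ≤ hi)
    (hU₂0 : 0 ≤ U₂) {v₂ : ℝ}
    (h₂ : ∀ (ω : InfVolFermionState 2) (Ls : ℕ → ℕ) (ψ : ∀ L, Fock (Orb (FermionTorus 2 L))),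
      Tendsto Ls atTop atTop →
      (∀ j, IsGroundStateInSector (hubbardTorusTT' (Ls j) 1 s₂ U₂) (rectN 1 (Ls j)) 0 (ψ (Ls j))) →
      (∀ j, star (ψ (Ls j)) ⬝ᵥ ψ (Ls j) = 1) → ω.IsTorusLimitOf ψ Ls →
      v₂ ≤ ((Finset.univ : Finset (DihedralGroup 4)).card : ℝ)⁻¹ * ∑ g ∈ (Finset.univ : Finset (DihedralGroup 4)),
        (ω.expect (d4ShiftSet g 0 (box 2 7)) (fermionEmbed (PolySite.d4Emb g 0 (box 2 7)) (-oddMomentObsTT s₂ Uo₂ 0))).re)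
    {A₂ : ℝ}
    (hA₂ : ∀ (ω : InfVolFermionState 2) (Ls : ℕ → ℕ) (ψ : ∀ L, Fock (Orb (FermionTorus 2 L))),
      Tendsto Ls atTop atTop →
      (∀ j, IsGroundStateInSector (hubbardTorusTT' (Ls j) 1 s₂ U₂) (rectN 1 (Ls j)) 0 (ψ (Ls j))) →
      (∀ j, star (ψ (Ls j)) ⬝ᵥ ψ (Ls j) = 1) → ω.IsTorusLimitOf ψ Ls →
      ω.meanEnergy (hubbardTTPrimeFermionInteraction 0 1 0) 1 ≤ A₂)
    {Ua Ub ta tb : ℝ} (hUa : U₁ < Ua) (hUBa : U₂ < Ua) (hab : Ua < Ub) (hbc : Ub ≤ Uc) (htab : ta < tb) (hta : 0 ≤ ta)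
    (hpr₁ : -(Ua * (-s₂) - U₂ * ta) ≤ 2 * s₂ * (Ua - U₂)) (hpr₂ : -(Ua * (-s₂) - U₂ * tb) ≤ 2 * s₂ * (Ua - U₂))
    (hpr₃ : -(Ub * (-s₂) - U₂ * ta) ≤ 2 * s₂ * (Ub - U₂)) (hpr₄ : -(Ub * (-s₂) - U₂ * tb) ≤ 2 * s₂ * (Ub - U₂))
    (hrt₁ : 2 * ta * (Ua - U₂) < Ua * (-s₂) - U₂ * ta) (hrt₂ : 2 * tb * (Ua - U₂) < Ua * (-s₂) - U₂ * tb)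
    (hrt₃ : 2 * ta * (Ub - U₂) < Ub * (-s₂) - U₂ * ta) (hrt₄ : 2 * tb * (Ub - U₂) < Ub * (-s₂) - U₂ * tb) (c : ℚ)
    (hPa : ∀ t ∈ Set.Icc ta tb, 0 ≤ 4 * ((c : ℚ) : ℝ) * ((Ua * (-s₂) - U₂ * t) * (Ua - U₁) - (-(U₁ * t)) * (Ua - U₂)) +
      ((Ua * (-s₂) - U₂ * t) - 2 * t * (Ua - U₂)) * (Ua * lo₁ - U₁ * hi) +
      (2 * t * (Ua - U₁) - (-(U₁ * t))) * (4 * v₂ * (Ua - U₂) + (-(Ua * (-s₂) - U₂ * t) - 2 * s₂ * (Ua - U₂)) * A₂))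
    (hPb : ∀ t ∈ Set.Icc ta tb, 0 ≤ 4 * ((c : ℚ) : ℝ) * ((Ub * (-s₂) - U₂ * t) * (Ub - U₁) - (-(U₁ * t)) * (Ub - U₂)) +
      ((Ub * (-s₂) - U₂ * t) - 2 * t * (Ub - U₂)) * (Ub * lo₁ - U₁ * hi) +
      (2 * t * (Ub - U₁) - (-(U₁ * t))) * (4 * v₂ * (Ub - U₂) + (-(Ub * (-s₂) - U₂ * t) - 2 * s₂ * (Ub - U₂)) * A₂))
    (hQa : ∀ t ∈ Set.Icc ta tb, 0 ≤ 4 * ((c : ℚ) : ℝ) * ((Ua * (-s₂) - U₂ * t) * (Ua - U₁) - (-(U₁ * t)) * (Ua - U₂)) +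
      ((Ua * (-s₂) - U₂ * t) - 2 * t * (Ua - U₂)) * (Ua * lo₁ - U₁ * hi) +
      (2 * t * (Ua - U₁) - (-(U₁ * t))) * (4 * v₂ * (Ua - U₂) + (-(Ua * (-s₂) - U₂ * t) - 2 * s₂ * (Ua - U₂)) * A₂) -
      (-(2 * s₂ * A₂ * t) + 8 * v₂ * t - 2 * lo₁ * t - lo₁ * s₂ - 4 * ((c : ℚ) : ℝ) * s₂) * ((Ub - Ua) ^ 2 / 4))
    (hQb : ∀ t ∈ Set.Icc ta tb, 0 ≤ 4 * ((c : ℚ) : ℝ) * ((Ub * (-s₂) - U₂ * t) * (Ub - U₁) - (-(U₁ * t)) * (Ub - U₂)) +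
      ((Ub * (-s₂) - U₂ * t) - 2 * t * (Ub - U₂)) * (Ub * lo₁ - U₁ * hi) +
      (2 * t * (Ub - U₁) - (-(U₁ * t))) * (4 * v₂ * (Ub - U₂) + (-(Ub * (-s₂) - U₂ * t) - 2 * s₂ * (Ub - U₂)) * A₂) -
      (-(2 * s₂ * A₂ * t) + 8 * v₂ * t - 2 * lo₁ * t - lo₁ * s₂ - 4 * ((c : ℚ) : ℝ) * s₂) * ((Ub - Ua) ^ 2 / 4)) :
    ∀ U ∈ Set.Icc Ua Ub, ∀ t ∈ Set.Icc ta tb, ObsStiffnessSeqCeilingAt t U 1 c := by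
  intro U hU t ht
  have hUa0 : 0 ≤ Ua := hU₁0.trans hUa.le
  have hpos : 0 < (Ub - Ua) * (tb - ta) := mul_pos (sub_pos.2 hab) (sub_pos.2 htab)
  have hpr : -(U * (-s₂) - U₂ * t) ≤ 2 * s₂ * (U - U₂) := by
    have h := box_corner_interp hU ht (sub_nonneg.2 hpr₁) (sub_nonneg.2 hpr₂) (sub_nonneg.2 hpr₃) (sub_nonneg.2 hpr₄)
    have key : (Ub - Ua) * (tb - ta) * (2 * s₂ * (U - U₂) - -(U * (-s₂) - U₂ * t)) =
        (Ub - U) * (tb - t) * (2 * s₂ * (Ua - U₂) - -(Ua * (-s₂) - U₂ * ta)) + (Ub - U) * (t - ta) * (2 * s₂ * (Ua - U₂) - -(Ua * (-s₂) - U₂ * tb)) +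
        (U - Ua) * (tb - t) * (2 * s₂ * (Ub - U₂) - -(Ub * (-s₂) - U₂ * ta)) + (U - Ua) * (t - ta) * (2 * s₂ * (Ub - U₂) - -(Ub * (-s₂) - U₂ * tb)) := by
      ring
    have hnn : 0 ≤ (Ub - Ua) * (tb - ta) * (2 * s₂ * (U - U₂) - -(U * (-s₂) - U₂ * t)) := by rw [key]; exact h
    have := (mul_nonneg_iff_of_pos_left hpos).1 hnn
    linarith
  have hrt : 2 * t * (U - U₂) < U * (-s₂) - U₂ * t := by
    obtain ⟨hUa', hUb'⟩ := hU
    obtain ⟨hta', htb'⟩ := ht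
    have key : (Ub - Ua) * (tb - ta) * ((U * (-s₂) - U₂ * t) - 2 * t * (U - U₂)) =
        (Ub - U) * (tb - t) * ((Ua * (-s₂) - U₂ * ta) - 2 * ta * (Ua - U₂)) + (Ub - U) * (t - ta) * ((Ua * (-s₂) - U₂ * tb) - 2 * tb * (Ua - U₂)) +
        (U - Ua) * (tb - t) * ((Ub * (-s₂) - U₂ * ta) - 2 * ta * (Ub - U₂)) + (U - Ua) * (t - ta) * ((Ub * (-s₂) - U₂ * tb) - 2 * tb * (Ub - U₂)) := by
      ring
    set m := min (min ((Ua * (-s₂) - U₂ * ta) - 2 * ta * (Ua - U₂)) ((Ua * (-s₂) - U₂ * tb) - 2 * tb * (Ua - U₂)))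
      (min ((Ub * (-s₂) - U₂ * ta) - 2 * ta * (Ub - U₂)) ((Ub * (-s₂) - U₂ * tb) - 2 * tb * (Ub - U₂))) with hm
    have hm0 : 0 < m := by
      simp only [hm, lt_min_iff]; exact ⟨⟨by linarith, by linarith⟩, ⟨by linarith, by linarith⟩⟩
    have hm1 : m ≤ (Ua * (-s₂) - U₂ * ta) - 2 * ta * (Ua - U₂) := le_trans (min_le_left _ _) (min_le_left _ _)
    have hm2 : m ≤ (Ua * (-s₂) - U₂ * tb) - 2 * tb * (Ua - U₂) := le_trans (min_le_left _ _) (min_le_right _ _)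
    have hm3 : m ≤ (Ub * (-s₂) - U₂ * ta) - 2 * ta * (Ub - U₂) := le_trans (min_le_right _ _) (min_le_left _ _)
    have hm4 : m ≤ (Ub * (-s₂) - U₂ * tb) - 2 * tb * (Ub - U₂) := le_trans (min_le_right _ _) (min_le_right _ _)
    have hw : (Ub - U) * (tb - t) + (Ub - U) * (t - ta) + (U - Ua) * (tb - t) + (U - Ua) * (t - ta) = (Ub - Ua) * (tb - ta) := by ring
    have hge : m * ((Ub - Ua) * (tb - ta)) ≤ (Ub - Ua) * (tb - ta) * ((U * (-s₂) - U₂ * t) - 2 * t * (U - U₂)) := by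
      rw [key, ← hw]
      nlinarith [mul_nonneg (sub_nonneg.2 hUb') (sub_nonneg.2 htb'), mul_nonneg (sub_nonneg.2 hUb') (sub_nonneg.2 hta'),
        mul_nonneg (sub_nonneg.2 hUa') (sub_nonneg.2 htb'), mul_nonneg (sub_nonneg.2 hUa') (sub_nonneg.2 hta')]
    have h2 : 0 < (Ub - Ua) * (tb - ta) * ((U * (-s₂) - U₂ * t) - 2 * t * (U - U₂)) := lt_of_lt_of_le (mul_pos hm0 hpos) hge
    have := (mul_pos_iff_of_pos_left hpos).1 h2
    linarith
  have hcapU : energyDensityTT' 1 t U 1 ≤ hi :=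
    energyDensityTT'_halfFilling_cap_of_tPrime_zero_cap_above t (hUa0.trans hU.1) (hU.2.trans hbc) hcap
  refine ObsStiffnessSeqCeilingAt_halfFilling_virtualStation_mirrorFanPriced_rightLeaf_cleared Uo₂ hU₁0 (hUa.trans_le hU.1) hfloor hcapU hU₂0 h₂ hA₂
    (hUBa.trans_le hU.1) (hta.trans ht.1) hpr hrt c ?_
  set q : ℝ := -(2 * s₂ * A₂ * t) + 8 * v₂ * t - 2 * lo₁ * t - lo₁ * s₂ - 4 * ((c : ℚ) : ℝ) * s₂ with hq
  set p : ℝ := 2 * U₂ * A₂ * t ^ 2 + 4 * s₂ * U₂ * A₂ * t + U₁ * s₂ * A₂ * t - 8 * U₂ * v₂ * t - 4 * U₁ * v₂ * t + 2 * hi * U₁ * t +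
    hi * U₁ * s₂ + lo₁ * U₂ * t - 4 * ((c : ℚ) : ℝ) * U₂ * t + 4 * ((c : ℚ) : ℝ) * U₁ * t + 4 * ((c : ℚ) : ℝ) * U₁ * s₂ with hp
  set r : ℝ := -(U₁ * U₂ * A₂ * t ^ 2) - 2 * U₁ * s₂ * U₂ * A₂ * t + 4 * U₁ * U₂ * v₂ * t - hi * U₁ * U₂ * t with hr
  have hPid : ∀ X : ℝ, 4 * ((c : ℚ) : ℝ) * ((X * (-s₂) - U₂ * t) * (X - U₁) - (-(U₁ * t)) * (X - U₂)) +
      ((X * (-s₂) - U₂ * t) - 2 * t * (X - U₂)) * (X * lo₁ - U₁ * hi) +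
      (2 * t * (X - U₁) - (-(U₁ * t))) * (4 * v₂ * (X - U₂) + (-(X * (-s₂) - U₂ * t) - 2 * s₂ * (X - U₂)) * A₂) = q * X ^ 2 + p * X + r := by
    intro X; rw [hq, hp, hr]; ring
  have ha := hPa t ht; have hb := hPb t ht; have haW := hQa t ht; have hbW := hQb t ht
  rw [hPid Ua] at ha haW; rw [hPid Ub] at hb hbW
  rw [hPid U]
  exact quadraticU_nonneg_on_box hab hU ha hb (by linarith) (by linarith)

end Box

end Summit.Ventures.CertifiedManyBodySolver.Observables

end
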